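import Literature.Probability.Percolation.FlipFairKernelZeroOne
import HarnessLib

/-!
# Flip-extremality forces density triviality

Topic `Literature/Probability/Percolation`; a proof-only companion of `FlipFairKernel.lean` and
`FlipFairKernelZeroOne.lean` (clauses (F) `IsFlipFairKernel`, (EXT) `IsFlipExtremal` of route
`Summits/CriticalPhenomena/CardyFormulaZ2/Theses/CardyMeckeFlip`, item FlipErgodicityZ2).

**Content.**  The two formulations of flip-ergodicity used by the route are equivalent for a
flip-fair probability law whose cylinder integrands are integrable:

* *midpoint form* (EXT, `IsFlipExtremal P M`): whenever two probability laws flip-fair for every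
  cutoff kernel `M ε`, `ε > 0`, average to `P` (`P₁ + P₂ = P + P`), then `P₁ = P`;
* *density form* (the conclusion shape of the route's item `PivotalKernelErgodic` / stub
  `stub_pivotalKernelErgodic`): every probability law `P.withDensity f` with `f ≤ 2` measurable
  that is flip-fair for every `M ε` equals `P`.

Density form ⇒ midpoint form is the landed `stub_flipExtremal_of_trivialDensity`
(`Summits/…/CardyMeckeFlipFlipErgodicityZ2StubFlipExtremalOfTrivialDensity.lean`, Radon–Nikodym).
This file proves the CONVERSE, `IsFlipExtremal.withDensity_eq`: given (EXT), flip-fairness of `P`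
and `P`-integrability of the cylinder integrands, a flip-fair tilt `P.withDensity f`, `f ≤ 2`, is
`P` — take `P₁ := P.withDensity f`, `P₂ := P.withDensity (2 - f)`; then `P₁ + P₂ = 2 • P = P + P`
(`withDensity_add_left`), `P₂` is a probability law, and `P₂` is flip-fair because Bochner
integrals are additive in the measure under integrability (which transfers to `P₁, P₂ ≤ 2 • P`), so
each side of (F) for `P₂` is the corresponding side for `P + P` minus that for `P₁`.  Hence the
skeleton cut of crux `FlipErgodicityZ2` through the density form loses nothing.

**Sources.**  The standard equivalence "extremal among stationary laws ⇔ no non-trivial bounded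
invariant density" for a reversible Markov dynamics, here the cut-off pivotal dynamics of
C. Garban, G. Pete, O. Schramm, JEMS 20 (2018), arXiv:1305.5526, §7.1, §11.1 (reversibility),
§12.1 (Remark: ergodicity open), in the Campbell–Mecke form (F); folklore otherwise.

**Design / not here.**  Proof-only, no definitions, no named facts; integrability of the cylinder
integrands is the hypothesis `hint` (for an admissible family it follows from (ADM)(3) and the
boundedness of cylinder test functions, not derived here).
-/

noncomputable section

open Set Filter
open _root_.MeasureTheory _root_.Topology
open scoped ENNReal

namespace Literature.Probability.Percolation

namespace QuadCrossing

variable {D : Set ℂ}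

/-- A tilt by a density bounded by `2` is dominated by twice the law: `P.withDensity f ≤ 2 • P`
for `f ≤ 2`. [folklore] -/
theorem withDensity_le_two_smul (P : Measure (QuadConfig D)) {f : QuadConfig D → ℝ≥0∞}
    (hf2 : ∀ S, f S ≤ 2) : P.withDensity f ≤ (2 : ℝ≥0∞) • P := by
  calc P.withDensity f ≤ P.withDensity fun _ => 2 := withDensity_mono (ae_of_all _ hf2)
    _ = (2 : ℝ≥0∞) • P := withDensity_const 2

/-- Integrability of a function against `P` transfers to every tilt `P.withDensity f` with
`f ≤ 2`. [folklore] -/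
theorem integrable_withDensity_of_le_two {P : Measure (QuadConfig D)} {f : QuadConfig D → ℝ≥0∞}
    (hf2 : ∀ S, f S ≤ 2) {g : QuadConfig D → ℝ} (hg : Integrable g P) :
    Integrable g (P.withDensity f) :=
  (hg.smul_measure ENNReal.ofNat_ne_top).mono_measure (withDensity_le_two_smul P hf2)

/-- **The complementary tilt.**  For `f ≤ 2` measurable,
`P.withDensity f + P.withDensity (2 - f) = P + P`. [folklore] -/
theorem withDensity_add_withDensity_two_sub (P : Measure (QuadConfig D)) {f : QuadConfig D → ℝ≥0∞}
    (hf : Measurable f) (hf2 : ∀ S, f S ≤ 2) :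
    P.withDensity f + P.withDensity (fun S => 2 - f S) = P + P := by
  rw [← withDensity_add_left hf]
  have h2 : (f + fun S => 2 - f S) = fun _ => (2 : ℝ≥0∞) :=
    funext fun S => by simp only [Pi.add_apply, add_tsub_cancel_of_le (hf2 S)]
  rw [h2, withDensity_const, two_smul]

/-- **Flip-extremality forces density triviality** (the converse of
`stub_flipExtremal_of_trivialDensity`).  Let the probability law `P` be flip-fair for every cutoff
kernel `M ε`, `ε > 0`, with `P`-integrable cylinder integrands, and flip-extremal (EXT).  Then
every probability law `P.withDensity f` with `f ≤ 2` measurable that is flip-fair for every `M ε`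
equals `P`: with `P₁ := P.withDensity f` and `P₂ := P.withDensity (2 - f)` one has
`P₁ + P₂ = P + P`, `P₂` is a probability law, and `P₂` is flip-fair (each side of (F) for `P₂` is
that for `P + P` minus that for `P₁`, by additivity of Bochner integrals in the measure under
integrability), so (EXT) gives `P₁ = P`.
[cite: GarbanPeteSchramm2018, §11.1 and §12.1 Remark (reversible limit dynamics; ergodicity)] -/
theorem IsFlipExtremal.withDensity_eq {P : Measure (QuadConfig D)} [IsProbabilityMeasure P]
    {M : ℝ → QuadConfig D → Measure ℂ} (hext : IsFlipExtremal P M)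
    (hff : ∀ ε : ℝ, 0 < ε → IsFlipFairKernel P (M ε))
    (hint : ∀ ε : ℝ, 0 < ε → ∀ (n : ℕ) (Q : Fin n → Quad D) (g : Set (Fin n) → ℝ) (φ : ℂ → ℝ),
      Continuous φ → HasCompactSupport φ →
        Integrable (fun S => ∫ x, φ x * g {i | Q i ∈ S} ∂M ε S) P ∧
          Integrable (fun S => ∫ x, φ x * g {i | Xor (Q i ∈ S) (S.IsPivotalAt x (Q i))} ∂M ε S) P)
    {f : QuadConfig D → ℝ≥0∞} (hf : Measurable f) (hf2 : ∀ S, f S ≤ 2)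
    (hprob : IsProbabilityMeasure (P.withDensity f))
    (hfair : ∀ ε : ℝ, 0 < ε → IsFlipFairKernel (P.withDensity f) (M ε)) :
    P.withDensity f = P := by
  set P₁ := P.withDensity f with hP₁
  set P₂ := P.withDensity (fun S => 2 - f S) with hP₂
  have hsum : P₁ + P₂ = P + P := withDensity_add_withDensity_two_sub P hf hf2
  have hg2 : ∀ S, (fun S => 2 - f S) S ≤ 2 := fun S => tsub_le_self
  -- `P₂` is a probability law: `1 + P₂ univ = 1 + 1`
  haveI hprob₂ : IsProbabilityMeasure P₂ := by
    refine ⟨(ENNReal.add_right_inj (measure_ne_top P₁ univ)).1 ?_⟩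
    have huniv : P₁ univ + P₂ univ = P univ + P univ := by
      rw [← Measure.add_apply, hsum, Measure.add_apply]
    rw [huniv, measure_univ, measure_univ]
  -- `P₂` is flip-fair: subtract (F) for `P₁` from (F) for `P + P`
  have hfair₂ : ∀ ε : ℝ, 0 < ε → IsFlipFairKernel P₂ (M ε) := by
    intro ε hε n Q g φ hφ hφc
    obtain ⟨hF, hG⟩ := hint ε hε n Q g φ hφ hφc
    have hF₁ : Integrable (fun S => ∫ x, φ x * g {i | Q i ∈ S} ∂M ε S) P₁ :=
      integrable_withDensity_of_le_two hf2 hF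
    have hG₁ : Integrable
        (fun S => ∫ x, φ x * g {i | Xor (Q i ∈ S) (S.IsPivotalAt x (Q i))} ∂M ε S) P₁ :=
      integrable_withDensity_of_le_two hf2 hG
    have hF₂ : Integrable (fun S => ∫ x, φ x * g {i | Q i ∈ S} ∂M ε S) P₂ :=
      integrable_withDensity_of_le_two hg2 hF
    have hG₂ : Integrable
        (fun S => ∫ x, φ x * g {i | Xor (Q i ∈ S) (S.IsPivotalAt x (Q i))} ∂M ε S) P₂ :=
      integrable_withDensity_of_le_two hg2 hG
    have eF : ∫ S, ∫ x, φ x * g {i | Q i ∈ S} ∂M ε S ∂P₁ +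
        ∫ S, ∫ x, φ x * g {i | Q i ∈ S} ∂M ε S ∂P₂ =
        ∫ S, ∫ x, φ x * g {i | Q i ∈ S} ∂M ε S ∂P + ∫ S, ∫ x, φ x * g {i | Q i ∈ S} ∂M ε S ∂P := by
      rw [← integral_add_measure hF₁ hF₂, hsum, integral_add_measure hF hF]
    have eG : ∫ S, ∫ x, φ x * g {i | Xor (Q i ∈ S) (S.IsPivotalAt x (Q i))} ∂M ε S ∂P₁ +
        ∫ S, ∫ x, φ x * g {i | Xor (Q i ∈ S) (S.IsPivotalAt x (Q i))} ∂M ε S ∂P₂ =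
        ∫ S, ∫ x, φ x * g {i | Xor (Q i ∈ S) (S.IsPivotalAt x (Q i))} ∂M ε S ∂P +
          ∫ S, ∫ x, φ x * g {i | Xor (Q i ∈ S) (S.IsPivotalAt x (Q i))} ∂M ε S ∂P := by
      rw [← integral_add_measure hG₁ hG₂, hsum, integral_add_measure hG hG]
    have e₁ := hfair ε hε n Q g φ hφ hφc
    have e := hff ε hε n Q g φ hφ hφc
    linarith
  exact hext P₁ P₂ hprob hprob₂ hfair hfair₂ hsum

end QuadCrossing

end Literature.Probability.Percolation
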